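import Literature.NumberTheory.Sieve.MontgomeryVaughan1975GaussSums
import Literature.NumberTheory.Sieve.TwistedWeightMellinInversion
import HarnessLib

/-!
# Smooth-weighted exponential sums at `a/q + λ/x`: expansion into characters

Topic `Literature/NumberTheory/Sieve`; a PROVED algebraic tool file toward
`Literature.NumberTheory.DiophantineGeometry.XYZUpperHalf` ([Harper2016, Cor. 1], major arcs at
`a/q`). With `W_λ(v) = v²(1−v)² e(λv)` (`TwistedWeight.twistWeight`) and the sums
`c_χ(n) = ∑_{h mod q} χ(h) e(hn/q)` (`MontgomeryVaughan1975.charGauss`), for `(a, q) = 1`: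

* `fourierChar_mul_div_eq_sum_charGauss`: `e(an/q) = φ(q)⁻¹ ∑_χ χ̄(a) c_χ(n)` for ALL `n`;
* `arcSum_eq_sum_char`: `∑_{n ∈ S(x,y)} e(an/q) W_λ(n/x) = φ(q)⁻¹ ∑_χ χ̄(a) T_χ`,
  `T_χ = ∑_{n ∈ S(x,y)} c_χ(n) W_λ(n/x)` (`charTwistSum`);
* `charTwistSum_one`: the principal `T_{χ₀} = ∑_{g ∣ q, g ∈ S(y)} μ(q/g) (φ(q)/φ(q/g)) U(x/g, q/g)` with
  `U(X, q') = ∑_{m ∈ S(X,y), (m,q')=1} W_λ(m/X)` (`coprimeTwistSum`), by von Sterneck's formula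
  `c_q(n) = μ(q/(q,n)) φ(q)/φ(q/(q,n))` and grouping `n` by `(q, n) = g`;
* `coprimeTwistSum_eq_sum_moebius`: `U(X, q') = ∑_{d ∣ q', d ∈ S(y)} μ(d) S_w(λ; X/d)`,
  `S_w(λ; X) = ∑_{k ∈ S(X,y)} W_λ(k/X)` (Möbius over `(m, q')`);
* `norm_charTwistSum_changeLevel_le`: for `χ` induced by a primitive `ψ (mod r)`,
  `|T_χ| ≤ φ(q) √r ∑_{g ∣ q} |∑_{m ∈ S(x/g,y)} (ψ̄ χ₀^{(q/g)})(m) W_λ(m/(x/g))|` (Lemma 5.4 of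
  Montgomery–Vaughan 1975 and the same grouping).

## References

* H. L. Montgomery, R. C. Vaughan, Acta Arith. 27 (1975), §5 [MontgomeryVaughanActa1975].
* A. J. Harper, Compositio Math. 152 (2016), §2.2, §5 [Harper2016].
-/

noncomputable section

open Finset Real Complex
open scoped ArithmeticFunction.Moebius FourierTransform

namespace Literature.NumberTheory.Sieve

namespace SmoothArcs

open MontgomeryVaughan1975 TwistedWeight

/-! ### `e(an/q)` in characters, for all `n` -/

/-- **`e(an/q) = φ(q)⁻¹ ∑_χ χ̄(a) c_χ(n)`** for `(a, q) = 1` and every `n` (orthogonality of the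
characters of `(ℤ/q)ˣ`). [cite: MontgomeryVaughanActa1975, §6 (6.1)] -/
theorem fourierChar_mul_div_eq_sum_charGauss {q : ℕ} [NeZero q] {a : ℕ} (ha : a.Coprime q) (n : ℕ) :
    (𝐞 ((a * n : ℝ) / q) : ℂ) =
      (q.totient : ℂ)⁻¹ * ∑ χ : DirichletCharacter ℂ q, χ⁻¹ (a : ZMod q) * charGauss χ (n : ZMod q) := by
  have hau : IsUnit (a : ZMod q) := (ZMod.isUnit_iff_coprime a q).mpr ha
  have hφ : (q.totient : ℂ) ≠ 0 := by exact_mod_cast (Nat.totient_pos.mpr (NeZero.pos q)).ne'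
  obtain ⟨u, hu⟩ := hau
  have hinv : ∀ χ : DirichletCharacter ℂ q, χ⁻¹ (a : ZMod q) = χ (a : ZMod q)⁻¹ := by
    intro χ
    rw [MulChar.inv_apply, ← hu, Ring.inverse_unit, ZMod.inv_coe_unit]
  have key : ∑ χ : DirichletCharacter ℂ q, χ⁻¹ (a : ZMod q) * charGauss χ (n : ZMod q) =
      (q.totient : ℂ) * (𝐞 ((a * n : ℝ) / q) : ℂ) := by
    simp_rw [hinv, charGauss_eq_sum, Finset.mul_sum]
    rw [Finset.sum_comm]
    have : ∀ m : ZMod q, ∑ χ : DirichletCharacter ℂ q, χ (a : ZMod q)⁻¹ * (χ m * ZMod.stdAddChar ((n : ZMod q) * m)) =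
        (if (a : ZMod q) = m then (q.totient : ℂ) else 0) * ZMod.stdAddChar ((n : ZMod q) * m) := by
      intro m
      rw [← DirichletCharacter.sum_char_inv_mul_char_eq ℂ ⟨u, hu⟩ m, Finset.sum_mul]
      refine Finset.sum_congr rfl fun χ _ => ?_
      ring
    simp_rw [this]
    simp only [ite_mul, zero_mul, Finset.sum_ite_eq, Finset.mem_univ, if_true]
    congr 1
    rw [show ((a * n : ℝ) / q) = (((n * a : ℕ) : ℤ) : ℝ) / q by push_cast; ring, fourierChar_div_eq_stdAddChar']
    push_cast; rfl
  rw [key, ← mul_assoc, inv_mul_cancel₀ hφ, one_mul]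

/-! ### The sums -/

/-- `S(a/q + λ/x) = ∑_{n ∈ S(x,y)} e(an/q) W_λ(n/x)` (the smooth-weighted exponential sum at
`θ = a/q + λ/x`: `e(nθ) w(n/x) = e(an/q) W_λ(n/x)`). [cite: Harper2016, §5] -/
def arcSum (x : ℝ) (y q a : ℕ) (lam : ℝ) : ℂ :=
  ∑ n ∈ Nat.smoothNumbersUpTo ⌊x⌋₊ (y + 1), (𝐞 ((a * n : ℝ) / q) : ℂ) * twistWeight lam (n / x)

/-- `T_χ = ∑_{n ∈ S(x,y)} c_χ(n) W_λ(n/x)`. [cite: MontgomeryVaughanActa1975, §6 (6.1)] -/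
def charTwistSum (x : ℝ) (y : ℕ) {q : ℕ} [NeZero q] (χ : DirichletCharacter ℂ q) (lam : ℝ) : ℂ :=
  ∑ n ∈ Nat.smoothNumbersUpTo ⌊x⌋₊ (y + 1), charGauss χ (n : ZMod q) * twistWeight lam (n / x)

/-- `U(X, q') = ∑_{m ∈ S(X,y), (m,q')=1} W_λ(m/X)`. [folklore] -/
def coprimeTwistSum (X : ℝ) (y q' : ℕ) (lam : ℝ) : ℂ :=
  ∑ m ∈ (Nat.smoothNumbersUpTo ⌊X⌋₊ (y + 1)).filter (fun m => m.Coprime q'), twistWeight lam (m / X)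

/-- `S_w(λ; X) = ∑_{k ∈ S(X,y)} W_λ(k/X)`. [cite: Harper2016, §5] -/
def smoothTwistSum (X : ℝ) (y : ℕ) (lam : ℝ) : ℂ :=
  ∑ k ∈ Nat.smoothNumbersUpTo ⌊X⌋₊ (y + 1), twistWeight lam (k / X)

/-- **`S(a/q+λ/x) = φ(q)⁻¹ ∑_χ χ̄(a) T_χ`**. [cite: MontgomeryVaughanActa1975, §6 (6.1)] -/
theorem arcSum_eq_sum_char (x : ℝ) (y : ℕ) {q : ℕ} [NeZero q] {a : ℕ} (ha : a.Coprime q) (lam : ℝ) :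
    arcSum x y q a lam =
      (q.totient : ℂ)⁻¹ * ∑ χ : DirichletCharacter ℂ q, χ⁻¹ (a : ZMod q) * charTwistSum x y χ lam := by
  unfold arcSum charTwistSum
  simp_rw [fourierChar_mul_div_eq_sum_charGauss ha, Finset.mul_sum, Finset.sum_mul, mul_assoc]
  rw [Finset.sum_comm]

/-! ### Grouping `n` by `(q, n) = g` -/

/-- For `g ∣ q`, `g ≥ 1`: `(q, g m) = g ↔ (m, q/g) = 1`. [folklore] -/
theorem gcd_mul_eq_iff {q g : ℕ} (hg : g ∣ q) (hg0 : 0 < g) (m : ℕ) :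
    Nat.gcd q (g * m) = g ↔ m.Coprime (q / g) := by
  obtain ⟨k, rfl⟩ := hg
  rw [Nat.mul_div_cancel_left k hg0, Nat.gcd_mul_left, Nat.Coprime, Nat.gcd_comm]
  constructor
  · intro h; exact (Nat.mul_right_inj hg0.ne').mp (by rw [h, mul_one])
  · intro h; rw [h, mul_one]

/-- The fibre of `n ↦ (q, n)` over `g`, inside `S(x, y)`: it is the image `m ↦ g m` of
`{m ∈ S(x/g, y) : (m, q/g) = 1}` when `g ∈ S(y)`, and empty otherwise. [folklore] -/
theorem filter_gcd_eq_image {x : ℝ} (hx : 0 ≤ x) {y q g : ℕ} (hg : g ∣ q) (hg0 : 0 < g)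
    (hgS : g ∈ Nat.smoothNumbers (y + 1)) :
    (Nat.smoothNumbersUpTo ⌊x⌋₊ (y + 1)).filter (fun n => Nat.gcd q n = g) =
      ((Nat.smoothNumbersUpTo ⌊x / g⌋₊ (y + 1)).filter (fun m => m.Coprime (q / g))).image (fun m => g * m) := by
  ext n
  simp only [Finset.mem_filter, Finset.mem_image, Nat.mem_smoothNumbersUpTo]
  constructor
  · rintro ⟨⟨hnx, hnS⟩, hgcd⟩
    have hgn : g ∣ n := hgcd ▸ Nat.gcd_dvd_right q n
    obtain ⟨m, rfl⟩ := hgn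
    refine ⟨m, ⟨⟨?_, ?_⟩, (gcd_mul_eq_iff hg hg0 m).mp hgcd⟩, rfl⟩
    · rw [Nat.le_floor_iff (by positivity), le_div_iff₀ (by exact_mod_cast hg0)]
      have := (Nat.le_floor_iff hx).mp hnx
      push_cast at this
      linarith [this]
    · exact Nat.mem_smoothNumbers_of_dvd hnS (dvd_mul_left m g)
  · rintro ⟨m, ⟨⟨hmx, hmS⟩, hcop⟩, rfl⟩
    refine ⟨⟨?_, Nat.mul_mem_smoothNumbers hgS hmS⟩, (gcd_mul_eq_iff hg hg0 m).mpr hcop⟩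
    rw [Nat.le_floor_iff hx]
    have := (Nat.le_floor_iff (by positivity)).mp hmx
    rw [le_div_iff₀ (by exact_mod_cast hg0)] at this
    push_cast
    linarith

/-- If `g ∉ S(y)` the fibre over `g` is empty. [folklore] -/
theorem filter_gcd_eq_empty {x : ℝ} {y q g : ℕ} (hgS : g ∉ Nat.smoothNumbers (y + 1)) :
    (Nat.smoothNumbersUpTo ⌊x⌋₊ (y + 1)).filter (fun n => Nat.gcd q n = g) = ∅ := by
  ext n
  simp only [Finset.mem_filter, Nat.mem_smoothNumbersUpTo, Finset.notMem_empty, iff_false, not_and]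
  rintro ⟨_, hnS⟩ hgcd
  have hgn : g ∣ n := hgcd ▸ Nat.gcd_dvd_right q n
  exact hgS (Nat.mem_smoothNumbers_of_dvd hnS hgn)

/-- A sum over `S(x,y)` grouped by `g = (q, n) ∣ q`. [folklore] -/
theorem sum_eq_sum_divisors_filter_gcd {q : ℕ} (hq : q ≠ 0) {x : ℝ} {y : ℕ} (F : ℕ → ℂ) :
    ∑ n ∈ Nat.smoothNumbersUpTo ⌊x⌋₊ (y + 1), F n =
      ∑ g ∈ q.divisors, ∑ n ∈ (Nat.smoothNumbersUpTo ⌊x⌋₊ (y + 1)).filter (fun n => Nat.gcd q n = g), F n := by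
  rw [← Finset.sum_fiberwise_of_maps_to (g := fun n => Nat.gcd q n) (t := q.divisors)]
  intro n _
  exact Nat.mem_divisors.mpr ⟨Nat.gcd_dvd_left q n, hq⟩

/-! ### The principal character: von Sterneck and the grouping -/

/-- **`T_{χ₀} = ∑_{g ∣ q, g ∈ S(y)} μ(q/g) (φ(q)/φ(q/g)) U(x/g, q/g)`**.
[cite: MontgomeryVaughanActa1975, §5 (5.2)] -/
theorem charTwistSum_one {x : ℝ} (hx : 0 ≤ x) (y : ℕ) {q : ℕ} [NeZero q] (lam : ℝ) :
    charTwistSum x y (1 : DirichletCharacter ℂ q) lam =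
      ∑ g ∈ q.divisors, if g ∈ Nat.smoothNumbers (y + 1) then
        (μ (q / g) : ℂ) * ((Nat.totient q / Nat.totient (q / g) : ℕ) : ℂ) * coprimeTwistSum (x / g) y (q / g) lam
        else 0 := by
  have hq : q ≠ 0 := NeZero.ne q
  unfold charTwistSum
  rw [sum_eq_sum_divisors_filter_gcd hq]
  refine Finset.sum_congr rfl fun g hg => ?_
  obtain ⟨hgq, -⟩ := Nat.mem_divisors.mp hg
  have hg0 : 0 < g := Nat.pos_of_dvd_of_pos hgq (NeZero.pos q)
  split_ifs with hgS
  · rw [filter_gcd_eq_image hx hgq hg0 hgS, Finset.sum_image (fun a _ b _ h => (Nat.mul_right_inj hg0.ne').mp h),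
      coprimeTwistSum, Finset.mul_sum]
    refine Finset.sum_congr rfl fun m hm => ?_
    obtain ⟨hm, hcop⟩ := Finset.mem_filter.mp hm
    have hm0 : m ≠ 0 := Nat.ne_zero_of_mem_smoothNumbers (Nat.mem_smoothNumbersUpTo.mp hm).2
    have hgm0 : g * m ≠ 0 := mul_ne_zero hg0.ne' hm0
    rw [charGauss_one_eq hgm0]
    have hred : redMod q (g * m) = q / g := by
      rw [redMod, (gcd_mul_eq_iff hgq hg0 m).mpr hcop]
    rw [hred]
    have hdiv : ((g * m : ℕ) : ℝ) / x = (m : ℝ) / (x / g) := by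
      have : (g : ℝ) ≠ 0 := by exact_mod_cast hg0.ne'
      push_cast
      field_simp
    rw [hdiv]
  · rw [filter_gcd_eq_empty hgS, Finset.sum_empty]

/-! ### Möbius over `(m, q') = 1` -/

/-- **`U(X, q') = ∑_{d ∣ q', d ∈ S(y)} μ(d) S_w(λ; X/d)`** for `q' ≥ 1`, `X ≥ 0`. [folklore] -/
theorem coprimeTwistSum_eq_sum_moebius {X : ℝ} (hX : 0 ≤ X) (y : ℕ) {q' : ℕ} (hq' : q' ≠ 0) (lam : ℝ) :
    coprimeTwistSum X y q' lam =
      ∑ d ∈ q'.divisors, if d ∈ Nat.smoothNumbers (y + 1) then (μ d : ℂ) * smoothTwistSum (X / d) y lam else 0 := by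
  unfold coprimeTwistSum
  -- insert the Möbius indicator
  have h1 : ∑ m ∈ (Nat.smoothNumbersUpTo ⌊X⌋₊ (y + 1)).filter (fun m => m.Coprime q'), twistWeight lam (m / X) =
      ∑ m ∈ Nat.smoothNumbersUpTo ⌊X⌋₊ (y + 1), (∑ d ∈ (Nat.gcd m q').divisors, (μ d : ℂ)) * twistWeight lam (m / X) := by
    rw [Finset.sum_filter]
    refine Finset.sum_congr rfl fun m _ => ?_
    rw [← coprime_indicator_eq_sum_moebius]
    split_ifs <;> simp
  rw [h1]
  -- swap: `∑_m ∑_{d ∣ (m,q')} = ∑_{d ∣ q'} ∑_{m : d ∣ m}`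
  have h2 : ∑ m ∈ Nat.smoothNumbersUpTo ⌊X⌋₊ (y + 1), (∑ d ∈ (Nat.gcd m q').divisors, (μ d : ℂ)) * twistWeight lam (m / X) =
      ∑ d ∈ q'.divisors, ∑ m ∈ (Nat.smoothNumbersUpTo ⌊X⌋₊ (y + 1)).filter (fun m => d ∣ m),
        (μ d : ℂ) * twistWeight lam (m / X) := by
    simp_rw [Finset.sum_mul]
    rw [Finset.sum_comm' (t' := q'.divisors)
      (s' := fun d => (Nat.smoothNumbersUpTo ⌊X⌋₊ (y + 1)).filter (fun m => d ∣ m))]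
    intro m d
    simp only [Finset.mem_filter, Nat.mem_divisors]
    constructor
    · rintro ⟨hm, hd, -⟩
      exact ⟨⟨hm, (Nat.dvd_gcd_iff.mp hd).1⟩, (Nat.dvd_gcd_iff.mp hd).2, hq'⟩
    · rintro ⟨⟨hm, hdm⟩, hdq, -⟩
      exact ⟨hm, Nat.dvd_gcd hdm hdq, Nat.gcd_ne_zero_right hq'⟩
  rw [h2]
  refine Finset.sum_congr rfl fun d hd => ?_
  obtain ⟨hdq, -⟩ := Nat.mem_divisors.mp hd
  have hd0 : 0 < d := Nat.pos_of_dvd_of_pos hdq (Nat.pos_of_ne_zero hq')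
  split_ifs with hdS
  · -- the multiples of `d` in `S(X,y)` are `d k`, `k ∈ S(X/d, y)`
    rw [smoothTwistSum, Finset.mul_sum]
    have himg : (Nat.smoothNumbersUpTo ⌊X⌋₊ (y + 1)).filter (fun m => d ∣ m) =
        (Nat.smoothNumbersUpTo ⌊X / d⌋₊ (y + 1)).image (fun k => d * k) := by
      ext m
      simp only [Finset.mem_filter, Finset.mem_image, Nat.mem_smoothNumbersUpTo]
      constructor
      · rintro ⟨⟨hmx, hmS⟩, ⟨k, rfl⟩⟩
        refine ⟨k, ⟨?_, Nat.mem_smoothNumbers_of_dvd hmS (dvd_mul_left k d)⟩, rfl⟩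
        rw [Nat.le_floor_iff (by positivity), le_div_iff₀ (by exact_mod_cast hd0)]
        have := (Nat.le_floor_iff hX).mp hmx
        push_cast at this
        linarith [this]
      · rintro ⟨k, ⟨hkx, hkS⟩, rfl⟩
        refine ⟨⟨?_, Nat.mul_mem_smoothNumbers hdS hkS⟩, dvd_mul_right d k⟩
        rw [Nat.le_floor_iff hX]
        have := (Nat.le_floor_iff (by positivity)).mp hkx
        rw [le_div_iff₀ (by exact_mod_cast hd0)] at this
        push_cast
        linarith
    rw [himg, Finset.sum_image (fun a _ b _ h => (Nat.mul_right_inj hd0.ne').mp h)]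
    refine Finset.sum_congr rfl fun k _ => ?_
    have hdiv : ((d * k : ℕ) : ℝ) / X = (k : ℝ) / (X / d) := by
      have : (d : ℝ) ≠ 0 := by exact_mod_cast hd0.ne'
      push_cast
      field_simp
    rw [hdiv]
  · -- `d ∉ S(y)`: no smooth multiple of `d`
    refine Finset.sum_eq_zero fun m hm => ?_
    obtain ⟨hm, hdm⟩ := Finset.mem_filter.mp hm
    have hmS := (Nat.mem_smoothNumbersUpTo.mp hm).2
    exact absurd (Nat.mem_smoothNumbers_of_dvd hmS hdm) hdS

/-! ### Induced characters: Lemma 5.4 and the grouping -/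

/-- **`|T_χ| ≤ φ(q) √r ∑_{g ∣ q} |∑_{m ∈ S(x/g,y)} ψ̄_{(q/g)}(m) W_λ(m/(x/g))|`** for `χ = ψχ₀`
induced by a primitive `ψ (mod r)`, `r ∣ q`; here `ψ̄_{(q/g)} = ψ⁻¹ χ₀^{(q/g)}` is `ψ̄` induced to
the modulus `q/g` (when `r ∣ q/g`; the terms with `r ∤ q/g` vanish).
[cite: MontgomeryVaughanActa1975, §5 Lemma 5.4 (5.1)] -/
theorem norm_charTwistSum_changeLevel_le {x : ℝ} (hx : 0 ≤ x) (y : ℕ) {q r : ℕ} [NeZero q] [NeZero r]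
    (h : r ∣ q) {ψ : DirichletCharacter ℂ r} (hψ : ψ.IsPrimitive) (lam : ℝ) :
    ‖charTwistSum x y (DirichletCharacter.changeLevel h ψ) lam‖ ≤
      (q.totient : ℝ) * Real.sqrt r * ∑ g ∈ q.divisors,
        if hrg : r ∣ q / g then
          ‖∑ m ∈ Nat.smoothNumbersUpTo ⌊x / g⌋₊ (y + 1),
            (DirichletCharacter.changeLevel hrg ψ⁻¹) (m : ZMod (q / g)) * twistWeight lam (m / (x / g))‖
        else 0 := by
  have hq : q ≠ 0 := NeZero.ne q
  unfold charTwistSum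
  rw [sum_eq_sum_divisors_filter_gcd hq, Finset.mul_sum]
  refine (norm_sum_le _ _).trans (Finset.sum_le_sum fun g hg => ?_)
  obtain ⟨hgq, -⟩ := Nat.mem_divisors.mp hg
  have hg0 : 0 < g := Nat.pos_of_dvd_of_pos hgq (NeZero.pos q)
  haveI : NeZero (q / g) := ⟨(Nat.div_ne_zero_iff_of_dvd hgq).mpr ⟨hq, hg0.ne'⟩⟩
  by_cases hgS : g ∈ Nat.smoothNumbers (y + 1)
  · rw [filter_gcd_eq_image hx hgq hg0 hgS, Finset.sum_image (fun a _ b _ h' => (Nat.mul_right_inj hg0.ne').mp h')]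
    -- evaluate `c_χ(g m)` by Lemma 5.4: `q₁ = q/g`, `m₁ = m`
    have hterm : ∀ m ∈ (Nat.smoothNumbersUpTo ⌊x / g⌋₊ (y + 1)).filter (fun m => m.Coprime (q / g)),
        charGauss (DirichletCharacter.changeLevel h ψ) ((g * m : ℕ) : ZMod q) * twistWeight lam ((g * m : ℕ) / x) =
        (if hrg : r ∣ q / g then
          ((Nat.totient q / Nat.totient (q / g) : ℕ) : ℂ) * (μ (q / g / r) : ℂ) * ψ ((q / g / r : ℕ) : ZMod r) *
            gaussSum ψ ZMod.stdAddChar *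
          ((DirichletCharacter.changeLevel hrg ψ⁻¹) (m : ZMod (q / g)) * twistWeight lam (m / (x / g)))
          else 0) := by
      intro m hm
      obtain ⟨hm, hcop⟩ := Finset.mem_filter.mp hm
      have hm0 : m ≠ 0 := Nat.ne_zero_of_mem_smoothNumbers (Nat.mem_smoothNumbersUpTo.mp hm).2
      have hgm0 : g * m ≠ 0 := mul_ne_zero hg0.ne' hm0
      have hgcd : Nat.gcd q (g * m) = g := (gcd_mul_eq_iff hgq hg0 m).mpr hcop
      have hred : redMod q (g * m) = q / g := by rw [redMod, hgcd]
      have harg : redArg q (g * m) = m := by rw [redArg, hgcd, Nat.mul_div_cancel_left m hg0]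
      have hdiv : ((g * m : ℕ) : ℝ) / x = (m : ℝ) / (x / g) := by
        have : (g : ℝ) ≠ 0 := by exact_mod_cast hg0.ne'
        push_cast
        field_simp
      rw [charGauss_changeLevel h hψ hgm0, hred, harg, hdiv]
      by_cases hrg : r ∣ q / g
      · rw [if_pos hrg, dif_pos hrg, changeLevel_apply_natCast hrg ψ⁻¹ m, if_pos hcop]
        ring
      · rw [if_neg hrg, dif_neg hrg, zero_mul]
    rw [Finset.sum_congr rfl hterm]
    by_cases hrg : r ∣ q / g
    · simp only [dif_pos hrg]
      rw [← Finset.mul_sum, norm_mul]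
      -- the coefficient has norm `≤ φ(q)/φ(q/g) · √r ≤ φ(q) √r`
      have hτ : ‖gaussSum ψ ZMod.stdAddChar‖ = Real.sqrt r := by
        rw [← Real.sqrt_sq (norm_nonneg _), Literature.NumberTheory.Sieve.LargeSieve.norm_gaussSum_sq hψ]
      have hcoef : ‖((Nat.totient q / Nat.totient (q / g) : ℕ) : ℂ) * (μ (q / g / r) : ℂ) * ψ ((q / g / r : ℕ) : ZMod r) *
          gaussSum ψ ZMod.stdAddChar‖ ≤ (q.totient : ℝ) * Real.sqrt r := by
        rw [norm_mul, norm_mul, norm_mul, hτ, Complex.norm_natCast]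
        have h1 : ((Nat.totient q / Nat.totient (q / g) : ℕ) : ℝ) ≤ (q.totient : ℝ) := by
          exact_mod_cast Nat.div_le_self _ _
        have h2 : ‖(μ (q / g / r) : ℂ)‖ ≤ 1 := by
          rw [Complex.norm_intCast]; exact_mod_cast ArithmeticFunction.abs_moebius_le_one
        have h3 : ‖ψ ((q / g / r : ℕ) : ZMod r)‖ ≤ 1 := DirichletCharacter.norm_le_one _ _
        have h0 : (0 : ℝ) ≤ ((Nat.totient q / Nat.totient (q / g) : ℕ) : ℝ) := by positivity
        calc ((Nat.totient q / Nat.totient (q / g) : ℕ) : ℝ) * ‖(μ (q / g / r) : ℂ)‖ * ‖ψ ((q / g / r : ℕ) : ZMod r)‖ *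
              Real.sqrt r ≤ (q.totient : ℝ) * 1 * 1 * Real.sqrt r := by gcongr
          _ = _ := by ring
      -- the filtered sum over `m` coprime to `q/g` equals the full sum (the character vanishes otherwise)
      have hfull : ∑ m ∈ (Nat.smoothNumbersUpTo ⌊x / g⌋₊ (y + 1)).filter (fun m => m.Coprime (q / g)),
          (DirichletCharacter.changeLevel hrg ψ⁻¹) (m : ZMod (q / g)) * twistWeight lam (m / (x / g)) =
          ∑ m ∈ Nat.smoothNumbersUpTo ⌊x / g⌋₊ (y + 1),
            (DirichletCharacter.changeLevel hrg ψ⁻¹) (m : ZMod (q / g)) * twistWeight lam (m / (x / g)) := by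
        rw [Finset.sum_filter]
        refine Finset.sum_congr rfl fun m _ => ?_
        split_ifs with hc
        · rfl
        · rw [changeLevel_apply_natCast hrg ψ⁻¹ m, if_neg hc, zero_mul]
      rw [hfull]
      exact mul_le_mul_of_nonneg_right hcoef (norm_nonneg _)
    · simp only [dif_neg hrg, Finset.sum_const_zero, norm_zero, mul_zero]; rfl
  · rw [filter_gcd_eq_empty hgS, Finset.sum_empty, norm_zero]
    split_ifs <;> positivity

end SmoothArcs

end Literature.NumberTheory.Sieve

end
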